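import Mathlib.Algebra.Order.BigOperators.Group.Finset
import Mathlib.Analysis.SpecialFunctions.Pow.Real
import Mathlib.Tactic.Linarith
import Mathlib.Tactic.Ring
import Mathlib.Tactic.Positivity
import HarnessLib
import HarnessLib.Audit

/-!
# `NoHeavyLowerTail` (crux stmt-CriticalPhenomena-4575), Sahi programme P4: nested pairs of the pair inequality are free

Support file (cell `prim-l12`, seat P4, generation 19; `--supports stmt-CriticalPhenomena-4575`).  No named facts, no sorries;
standard axioms; def-free.

In the flow/sandwich certificates of `…SahiE3PatternCertificate` / `…SahiE3CertSandwich` the pair inequality reads, for up-sets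
`S, S'` of the pattern and the slot `U` (`Z = Σ ν`, `N_U = Σ_U ν`, `N(S) = Σ_S ν`, `N_U(S) = Σ_{S∩U} ν`),
  (L)  `Z·(N(S)·N_U(S') + N(S')·N_U(S)) − N_U·N(S)·N(S') ≤ Σ_{t ∈ S∩S'} R t`,
and (L) at `(W, univ)` is the DOMINATION `Z²·N_U(W) ≤ Σ_{t∈W} R t`.  THEOREM `need_le_of_subset`: for NESTED pairs `S ⊆ S'` the
left-hand side of (L) is at most `Z²·N_U(S ∩ S')`, using only `ν ≥ 0` and the positive correlation `N_U·N(S) ≤ Z·N_U(S)` of `S` with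
`U` (Harris' inequality when `S, U` are up-sets of a Harris space); hence (`pair_of_dominating_of_subset`) domination alone gives (L)
at every nested pair — the pair inequality has content only at CROSSING pairs.  This is LEMMA N of HOME
prim-l12-p4/FROM-prim-l12-p4-gen19-POLARIZATION.md, where it explains why the certificate input needed per diagonal column of the
independent OR-step is `max(pair, domination)`.
-/

namespace Summit.CriticalPhenomena.PercolationContinuityZ3.Theorems.SahiE3NestedPairs

open Finset
open scoped BigOperators

variable {P : Type*} [Fintype P] [DecidableEq P]

/-- **Nested pairs are free.**  `ν ≥ 0` on a finite type, `U S S'` finite sets with `S ⊆ S'` and `S` positively correlated with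
`U` (`N_U·N(S) ≤ Z·N_U(S)`).  Then the left-hand side of the pair inequality (L) at `(S, S')` is at most `Z²·N_U(S ∩ S')`.
[this work] -/
theorem need_le_of_subset (ν : P → ℝ) (hν : ∀ t, 0 ≤ ν t) (U S S' : Finset P) (hSS' : S ⊆ S')
    (hH : (∑ t ∈ U, ν t) * (∑ t ∈ S, ν t) ≤ (∑ t, ν t) * (∑ t ∈ S ∩ U, ν t)) :
    (∑ r, ν r) * ((∑ t ∈ S, ν t) * (∑ t ∈ S' ∩ U, ν t) + (∑ t ∈ S', ν t) * (∑ t ∈ S ∩ U, ν t))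
        - (∑ r ∈ U, ν r) * (∑ t ∈ S, ν t) * (∑ t ∈ S', ν t)
      ≤ (∑ r, ν r) * (∑ r, ν r) * (∑ t ∈ (S ∩ S') ∩ U, ν t) := by
  have hSS : S ∩ S' = S := Finset.inter_eq_left.2 hSS'
  rw [hSS]
  obtain ⟨Z, hZ⟩ : ∃ x : ℝ, ∑ t, ν t = x := ⟨_, rfl⟩
  obtain ⟨NU, hNU⟩ : ∃ x : ℝ, ∑ t ∈ U, ν t = x := ⟨_, rfl⟩
  obtain ⟨nS, hnS⟩ : ∃ x : ℝ, ∑ t ∈ S, ν t = x := ⟨_, rfl⟩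
  obtain ⟨nS', hnS'⟩ : ∃ x : ℝ, ∑ t ∈ S', ν t = x := ⟨_, rfl⟩
  obtain ⟨uS, huS⟩ : ∃ x : ℝ, ∑ t ∈ S ∩ U, ν t = x := ⟨_, rfl⟩
  obtain ⟨uS', huS'⟩ : ∃ x : ℝ, ∑ t ∈ S' ∩ U, ν t = x := ⟨_, rfl⟩
  -- elementary facts
  have h1 : uS' ≤ NU := by
    rw [← huS', ← hNU]; exact Finset.sum_le_sum_of_subset_of_nonneg Finset.inter_subset_right fun t _ _ => hν t
  have h2 : nS' ≤ Z := by
    rw [← hnS', ← hZ]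
    exact Finset.sum_le_sum_of_subset_of_nonneg (Finset.subset_univ S') fun t _ _ => hν t
  have h3 : 0 ≤ nS := by rw [← hnS]; exact Finset.sum_nonneg fun t _ => hν t
  have h4 : 0 ≤ uS := by rw [← huS]; exact Finset.sum_nonneg fun t _ => hν t
  have h5 : 0 ≤ Z := by rw [← hZ]; exact Finset.sum_nonneg fun t _ => hν t
  have h6 : uS' ≤ nS' := by
    rw [← huS', ← hnS']; exact Finset.sum_le_sum_of_subset_of_nonneg Finset.inter_subset_left fun t _ _ => hν t
  rw [hZ, hNU, hnS, hnS', huS, huS']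
  rw [hNU, hnS, hZ, huS] at hH
  -- need − Z²·N_U(S) = nS·(Z·uS' − NU·nS') − Z·uS·(Z − nS') ≤ nS·NU·(Z − nS') − Z·uS·(Z − nS') = (Z − nS')(NU·nS − Z·uS) ≤ 0
  have step1 : nS * (Z * uS' - NU * nS') ≤ nS * (NU * (Z - nS')) := by
    apply mul_le_mul_of_nonneg_left _ h3
    nlinarith [h1, h5]
  nlinarith [step1, hH, h2, h4]

/-- **Domination gives the pair inequality at nested pairs.**  If `R` dominates `Z²·ν` on `U` along the set `S ∩ S'` (the instance
`(S ∩ S', univ)` of (L)), then (L) holds at the nested pair `S ⊆ S'`. [this work] -/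
theorem pair_of_dominating_of_subset (ν : P → ℝ) (hν : ∀ t, 0 ≤ ν t) (U S S' : Finset P) (hSS' : S ⊆ S')
    (hH : (∑ t ∈ U, ν t) * (∑ t ∈ S, ν t) ≤ (∑ t, ν t) * (∑ t ∈ S ∩ U, ν t)) (R : P → ℝ)
    (hdom : (∑ r, ν r) * (∑ r, ν r) * (∑ t ∈ (S ∩ S') ∩ U, ν t) ≤ ∑ t ∈ S ∩ S', R t) :
    (∑ r, ν r) * ((∑ t ∈ S, ν t) * (∑ t ∈ S' ∩ U, ν t) + (∑ t ∈ S', ν t) * (∑ t ∈ S ∩ U, ν t))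
        - (∑ r ∈ U, ν r) * (∑ t ∈ S, ν t) * (∑ t ∈ S', ν t) ≤ ∑ t ∈ S ∩ S', R t :=
  le_trans (need_le_of_subset ν hν U S S' hSS' hH) hdom

end Summit.CriticalPhenomena.PercolationContinuityZ3.Theorems.SahiE3NestedPairs
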